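import Literature.MathematicalPhysics.QuantumLattice.HubbardGrassmannMomentSeriesLimit
import Literature.MathematicalPhysics.QuantumLattice.ShiftedHubbardDysonDeterminant
import Literature.MathematicalPhysics.QuantumLattice.HubbardFreePropagatorLimit
import Literature.MathematicalPhysics.QuantumLattice.OrderedIntegralSymmetrization
import Literature.MathematicalPhysics.QuantumLattice.OrderedIntegralSymmetric
import Mathlib.MeasureTheory.Measure.Haar.NormedSpace
import HarnessLib

/-!
# The Matsubara ultraviolet limit of the Grassmann partition function IS the Hamiltonian trace

Topic `MathematicalPhysics/QuantumLattice`; the final identification of the `M → ∞` ("Matsubara UV") bridge for the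
partition function of the repulsive Hubbard torus at zero pair seed.  `HubbardGrassmannMomentSeriesLimit` showed that
the normalised finite-frequency Grassmann integral `∫dμ_{C_M} e^{-V}` (`effPartitionFn` of `hubbardCovariance L M β μ 0`
and `hubbardInteraction L M β U`) converges, for `2e|U|L²βB² < 1`, to the determinant series
`Σ_n ((−1)ⁿ/n!) Uⁿ Σ_{x⃗} ∫_{[0,β]ⁿ} det[vertexLimitEntry]`; `ShiftedHubbardDysonDeterminant` expanded the Hamiltonian
trace `Tr e^{-β(H(1,U) − (μ+Uν)N)}` in TIME-ORDERED determinants `det(propMatrix − ν·1)`.  Here the two are matched,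
with the counterterm `ν = ½` FORCED by the symmetric frequency truncation (the equal-time value of the truncated
propagator is the midpoint `½ − n_F`, `MatsubaraTruncationMidpoint`):

* `setIntegral_cube_eq_factorial_mul_setIntegral_simplex` — symmetrisation `∫_{[0,t]^k} Φ = k! ∫_{Δ_k(t)} Φ` for
  INTEGRABLE symmetric `Φ` (the tree's `orderedIntegral_eq_inv_factorial_smul_setIntegral_cube` minus continuity —
  the limiting integrand jumps at coinciding times); `setIntegral_Icc_eq_pow_mul_setIntegral_unit_cube` (`τ = βu`);
* `vertexLimitDet` — the limiting Wick determinant of `n` vertices; `measurable_vertexLimitDet`,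
  `norm_vertexLimitDet_le`, `vertexLimitDet_perm` (joint relabelling of the vertices), `sum_vertexLimitDet_perm`
  (the vertex sum is a SYMMETRIC function of the times);
* `propMatrix_torus_orb_apply` — for `L ≥ 3` the time-ordered propagator matrix of the torus (plane-wave
  diagonalisation, `exp_smul_hubbardOneBody_eq_torusMultiplier`) as momentum sums;
* **`propMatrix_sub_half_eq_transpose_vertexLimit`** — on the open simplex (strictly increasing times) the shifted
  Hamiltonian matrix `propMatrix(x⃗, −βu) − ½·1` is the TRANSPOSE of the Grassmann limit matrix at `τ = βu`
  (both branches of BGM (1.4) and the diagonal midpoint), hence `vertexLimitDet x (β•u) = det(propMatrix − ½·1)`;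
* **`hasSum_vertexLimitDet_series`** — the Grassmann limit series sums to
  `e^{-βUL²/4} · Tr e^{-β(H_L(1,U) − (μ + U/2)N)} / Tr e^{-β(H_L(1,0) − μN)}`;
* **`tendsto_effPartitionFn_hubbard_eq_partitionFn_div`** — THE BRIDGE: for `L ≥ 3`, `β > 0`, `2e|U|L²βB² < 1`,
  `∫dμ_{C_M} e^{-V_M(U)} ⟶ e^{-βUL²/4} Z_L(β; U, μ + U/2) / Z_L(β; 0, μ)` as `M → ∞`
  (`Z_L(β; U, μ) = Tr e^{-β hubbardTorusWith 2 L 1 U μ}`): the finite-`M` Grassmann representation with interaction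
  `U∫ψ⁺↑ψ⁻↑ψ⁺↓ψ⁻↓` describes the Hubbard torus with the HALF-FILLING-SYMMETRISED interaction `UΣ(n↑−½)(n↓−½)`,
  i.e. at chemical potential shifted by `U/2` and energy shifted by `UL²/4`.

## Sources

G. Benfatto, A. Giuliani, V. Mastropietro, Ann. Henri Poincaré 7 (2006) 809–898 = arXiv:cond-mat/0507686, §1.2
(1.2)–(1.4), §2.1 (2.3)–(2.8) [`BenfattoGiulianiMastropietro2006`]; O. Bratteli, D. W. Robinson, *Operator Algebras and
Quantum Statistical Mechanics I* (1987), Thm. 3.1.33 (symmetrisation) [`BratteliRobinsonI1987`].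
-/

noncomputable section

namespace Literature.MathematicalPhysics.QuantumLattice

open Finset Filter _root_.MeasureTheory Literature.Probability.LatticeModels _root_.Topology NormedSpace
open scoped Nat Pointwise ComplexOrder

/-! ### A. Symmetrisation and scaling of cube integrals -/

section Cube

/-- **Symmetrisation for integrable symmetric integrands**: `∫_{[0,t]^k} Φ = k! ∫_{Δ_k(t)} Φ`,
`Δ_k(t) = {0 ≤ w₀ ≤ ⋯ ≤ w_{k-1} ≤ t}` (the cube is a.e. the disjoint union of the `k!` strict simplices, each carrying the
same integral; no continuity needed). [cite: BratteliRobinsonI1987, Thm. 3.1.33] -/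
theorem setIntegral_cube_eq_factorial_mul_setIntegral_simplex (k : ℕ) (t : ℝ) (Φ : (Fin k → ℝ) → ℂ)
    (hsym : ∀ (σ : Equiv.Perm (Fin k)) (w : Fin k → ℝ), Φ (fun i => w (σ i)) = Φ w)
    (hInt : IntegrableOn Φ (Set.pi Set.univ fun _ : Fin k => Set.Icc (0 : ℝ) t) volume) :
    ∫ w in Set.pi Set.univ (fun _ : Fin k => Set.Icc (0 : ℝ) t), Φ w =
      (k ! : ℂ) * ∫ w in {w : Fin k → ℝ | (∀ i, w i ∈ Set.Icc (0 : ℝ) t) ∧ Monotone w}, Φ w := by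
  classical
  set cube : Set (Fin k → ℝ) := Set.pi Set.univ (fun _ : Fin k => Set.Icc (0 : ℝ) t) with hcube
  set P : Equiv.Perm (Fin k) → Set (Fin k → ℝ) := fun σ =>
    {w | (∀ i, w i ∈ Set.Icc (0 : ℝ) t) ∧ StrictMono (fun i => w (σ i))} with hP
  have hsub : (⋃ σ ∈ (Finset.univ : Finset (Equiv.Perm (Fin k))), P σ) ⊆ cube := by
    intro w hw
    obtain ⟨σ, -, hwσ⟩ := Set.mem_iUnion₂.mp hw
    exact Set.mem_univ_pi.mpr hwσ.1
  have hae : cube =ᵐ[volume] ⋃ σ ∈ (Finset.univ : Finset (Equiv.Perm (Fin k))), P σ := by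
    refine ae_eq_set.mpr ⟨?_, ?_⟩
    · exact measure_mono_null (cube_diff_iUnion_strictSimplex_subset k t) (volume_coincidence_eq_zero k)
    · rw [Set.sdiff_eq_empty.mpr hsub, measure_empty]
  have hsplit : ∫ w in cube, Φ w = ∑ σ ∈ (Finset.univ : Finset (Equiv.Perm (Fin k))), ∫ w in P σ, Φ w := by
    rw [setIntegral_congr_set hae]
    refine integral_biUnion_finset _ (fun σ _ => measurableSet_strictSimplex k t σ) ?_ (fun σ _ => ?_)
    · intro σ _ τ _ hστ
      exact disjoint_strictSimplex k t hστ
    · exact hInt.mono_set (fun w hw => Set.mem_univ_pi.mpr hw.1)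
  have hterm : ∀ σ : Equiv.Perm (Fin k), ∫ w in P σ, Φ w =
      ∫ w in {w : Fin k → ℝ | (∀ i, w i ∈ Set.Icc (0 : ℝ) t) ∧ Monotone w}, Φ w := fun σ =>
    setIntegral_strictSimplex_eq k t Φ hsym σ
  rw [hsplit, Finset.sum_congr rfl (fun σ _ => hterm σ), Finset.sum_const, Finset.card_univ, Fintype.card_perm,
    Fintype.card_fin, nsmul_eq_mul]

/-- **Scaling the time cube**: `∫_{[0,β]^k} Φ(τ) dτ = β^k ∫_{[0,1]^k} Φ(βu) du` (`β > 0`). [folklore] -/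
theorem setIntegral_Icc_eq_pow_mul_setIntegral_unit_cube {k : ℕ} {β : ℝ} (hβ : 0 < β) (Φ : (Fin k → ℝ) → ℂ) :
    ∫ τ in Set.Icc (0 : Fin k → ℝ) (fun _ => β), Φ τ =
      (β : ℂ) ^ k * ∫ u in Set.pi Set.univ (fun _ : Fin k => Set.Icc (0 : ℝ) 1), Φ (β • u) := by
  have hset : β • Set.pi Set.univ (fun _ : Fin k => Set.Icc (0 : ℝ) 1) = Set.Icc (0 : Fin k → ℝ) (fun _ => β) := by
    ext w
    rw [Set.mem_smul_set_iff_inv_smul_mem₀ hβ.ne', Set.mem_univ_pi, Set.mem_Icc]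
    simp only [Pi.smul_apply, smul_eq_mul, Set.mem_Icc, Pi.le_def, Pi.zero_apply]
    constructor
    · intro h
      refine ⟨fun i => ?_, fun i => ?_⟩
      · exact (mul_nonneg_iff_of_pos_left (inv_pos.2 hβ)).1 (h i).1
      · have h2 := (h i).2
        rw [inv_mul_le_iff₀ hβ, mul_one] at h2
        exact h2
    · intro h i
      refine ⟨mul_nonneg (inv_nonneg.2 hβ.le) (h.1 i), ?_⟩
      rw [inv_mul_le_iff₀ hβ, mul_one]
      exact h.2 i
  have key := Measure.setIntegral_comp_smul_of_pos (μ := (volume : Measure (Fin k → ℝ))) Φ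
    (Set.pi Set.univ (fun _ : Fin k => Set.Icc (0 : ℝ) 1)) hβ
  rw [hset, Module.finrank_fin_fun] at key
  rw [key, Complex.real_smul]
  have hβ' : (β : ℂ) ≠ 0 := by exact_mod_cast hβ.ne'
  push_cast
  rw [← mul_assoc, mul_inv_cancel₀ (pow_ne_zero _ hβ'), one_mul]

/-- Bounded measurable functions are integrable on sets of finite measure. [folklore] -/
theorem integrableOn_of_measurable_of_norm_le {k : ℕ} {s : Set (Fin k → ℝ)} (hs : MeasurableSet s)
    (hsfin : volume s ≠ ⊤) {Φ : (Fin k → ℝ) → ℂ} (hΦ : Measurable Φ) {B : ℝ} (hB : ∀ w ∈ s, ‖Φ w‖ ≤ B) :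
    IntegrableOn Φ s volume :=
  Measure.integrableOn_of_bounded hsfin hΦ.aestronglyMeasurable ((ae_restrict_iff' hs).2 (Eventually.of_forall hB))

end Cube

/-! ### B. The limiting Wick determinant: measurability, bound, symmetry -/

section LimitDet

variable (L : ℕ) [NeZero L]

/-- **The limiting Wick determinant of `n` vertices** at sites `x⃗` and times `τ`:
`det[vertexLimitEntry(x⃗_{aᵢ}, x⃗_{aⱼ}, σᵢ, σⱼ; τ_{aⱼ} − τ_{aᵢ})]_{i,j < 2n}` with the standard pair enumeration
`finProdFinEquiv.symm i = (aᵢ, σᵢ)` (the `M → ∞` limit of the integrands of `∫dμ_{C_M} Vⁿ`,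
`tendsto_gaussExpect_hubbardInteraction_pow`). [cite: BenfattoGiulianiMastropietro2006, §2.1 (2.6)-(2.8)] -/
def vertexLimitDet (β μ : ℝ) {n : ℕ} (x : Fin n → TorusSite 2 L) (τ : Fin n → ℝ) : ℂ :=
  (Matrix.of fun i j : Fin (n * 2) =>
    vertexLimitEntry L β μ (x (finProdFinEquiv.symm i : Fin n × Fin 2).1)
      (x (finProdFinEquiv.symm j : Fin n × Fin 2).1) (finProdFinEquiv.symm i : Fin n × Fin 2).2
      (finProdFinEquiv.symm j : Fin n × Fin 2).2
      (τ (finProdFinEquiv.symm j : Fin n × Fin 2).1 - τ (finProdFinEquiv.symm i : Fin n × Fin 2).1)).det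

variable {L}

/-- Unfolding `vertexLimitDet`. [folklore] -/
theorem vertexLimitDet_eq (β μ : ℝ) {n : ℕ} (x : Fin n → TorusSite 2 L) (τ : Fin n → ℝ) :
    vertexLimitDet L β μ x τ = (Matrix.of fun i j : Fin (n * 2) =>
      vertexLimitEntry L β μ (x (finProdFinEquiv.symm i : Fin n × Fin 2).1)
        (x (finProdFinEquiv.symm j : Fin n × Fin 2).1) (finProdFinEquiv.symm i : Fin n × Fin 2).2
        (finProdFinEquiv.symm j : Fin n × Fin 2).2
        (τ (finProdFinEquiv.symm j : Fin n × Fin 2).1 - τ (finProdFinEquiv.symm i : Fin n × Fin 2).1)).det := rfl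

omit [NeZero L] in
/-- The scalar time-ordered propagator is measurable (piecewise continuous). [folklore] -/
theorem measurable_timeOrderedPropagator (β ξ : ℝ) : Measurable (timeOrderedPropagator β ξ) := by
  unfold timeOrderedPropagator
  refine Measurable.ite measurableSet_Ioi ?_ (Measurable.ite measurableSet_Iio ?_ measurable_const)
  · exact measurable_const.mul (Real.measurable_exp.comp (measurable_const.mul measurable_id).neg)
  · exact (measurable_const.mul (Real.measurable_exp.comp (measurable_const.mul measurable_id).neg)).neg

/-- The limiting entries in character form:
`vertexLimitEntry … x⃗_a x⃗_b σ σ' s = −[σ=σ'] L⁻² Σ_q χ_q(x⃗_a − x⃗_b) G_β(ξ_q, s)`. [folklore] -/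
theorem vertexLimitEntry_eq_torusChar (β μ : ℝ) (xa xb : TorusSite 2 L) (σ σ' : Fin 2) (s : ℝ) :
    vertexLimitEntry L β μ xa xb σ σ' s = -(if σ = σ' then ((1 / (L : ℝ) ^ 2 : ℝ) : ℂ) * ∑ q : TorusSite 2 L,
      torusChar q (xa - xb) * ((timeOrderedPropagator β (nambuXi L μ q) s : ℝ) : ℂ) else 0) := by
  unfold vertexLimitEntry
  simp only [exp_latticeMomentum_phase_eq_torusChar]

/-- The limiting entries are measurable in the vertex times. [folklore] -/
theorem measurable_vertexLimitEntry_sub (β μ : ℝ) (xa xb : TorusSite 2 L) (σ σ' : Fin 2) {n : ℕ} (a b : Fin n) :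
    Measurable fun τ : Fin n → ℝ => vertexLimitEntry L β μ xa xb σ σ' (τ b - τ a) := by
  simp only [vertexLimitEntry_eq_torusChar]
  refine Measurable.neg ?_
  split_ifs
  · refine measurable_const.mul (Finset.measurable_sum _ fun q _ => measurable_const.mul ?_)
    exact Complex.measurable_ofReal.comp ((measurable_timeOrderedPropagator β _).comp
      ((measurable_pi_apply b).sub (measurable_pi_apply a)))
  · exact measurable_const

/-- The limiting Wick determinant is measurable in the vertex times. [folklore] -/
theorem measurable_vertexLimitDet (β μ : ℝ) {n : ℕ} (x : Fin n → TorusSite 2 L) :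
    Measurable fun τ : Fin n → ℝ => vertexLimitDet L β μ x τ := by
  unfold vertexLimitDet
  simp only [Matrix.det_apply', Matrix.of_apply]
  refine Finset.measurable_sum _ fun σ _ => measurable_const.mul (Finset.measurable_prod _ fun i _ => ?_)
  exact measurable_vertexLimitEntry_sub β μ _ _ _ _ _ _

/-- Entry bound on the cube: for `|s| ≤ β`, `‖vertexLimitEntry … s‖ ≤ L⁻² Σ_q e^{β|ξ_q|}`. [folklore] -/
theorem norm_vertexLimitEntry_le (β μ : ℝ) (xa xb : TorusSite 2 L) (σ σ' : Fin 2) {s : ℝ}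
    (hs : |s| ≤ β) :
    ‖vertexLimitEntry L β μ xa xb σ σ' s‖ ≤
      (1 / (L : ℝ) ^ 2) * ∑ q : TorusSite 2 L, Real.exp (β * |nambuXi L μ q|) := by
  rw [vertexLimitEntry_eq_torusChar, norm_neg]
  split_ifs
  · rw [norm_mul, Complex.norm_real, Real.norm_eq_abs, abs_of_nonneg (by positivity)]
    gcongr
    refine (norm_sum_le _ _).trans (sum_le_sum fun q _ => ?_)
    rw [norm_mul, norm_torusChar, one_mul, Complex.norm_real, Real.norm_eq_abs]
    refine (abs_timeOrderedPropagator_le β _ s).trans (Real.exp_le_exp.2 ?_)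
    rw [mul_comm]
    exact mul_le_mul_of_nonneg_right hs (abs_nonneg _)
  · rw [norm_zero]
    positivity

/-- **Uniform bound for the limiting determinant on the time cube** (Hadamard):
`‖vertexLimitDet x τ‖ ≤ ((2n) B₁²)ⁿ`, `B₁ = L⁻² Σ_q e^{β|ξ_q|}`, for `τ ∈ [0,β]ⁿ`. [folklore] -/
theorem norm_vertexLimitDet_le (β μ : ℝ) {n : ℕ} (x : Fin n → TorusSite 2 L)
    {τ : Fin n → ℝ} (hτ : τ ∈ Set.Icc (0 : Fin n → ℝ) (fun _ => β)) :
    ‖vertexLimitDet L β μ x τ‖ ≤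
      (((n * 2 : ℕ) : ℝ) * ((1 / (L : ℝ) ^ 2) * ∑ q : TorusSite 2 L, Real.exp (β * |nambuXi L μ q|)) ^ 2) ^ n := by
  refine norm_det_le_of_entry_le _ fun i j => ?_
  rw [Matrix.of_apply]
  refine norm_vertexLimitEntry_le β μ _ _ _ _ ?_
  have h1 : ∀ a, 0 ≤ τ a := fun a => hτ.1 a
  have h2 : ∀ a, τ a ≤ β := fun a => hτ.2 a
  rw [abs_le]
  constructor <;> linarith [h1 (finProdFinEquiv.symm j : Fin n × Fin 2).1, h2 (finProdFinEquiv.symm j : Fin n × Fin 2).1,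
    h1 (finProdFinEquiv.symm i : Fin n × Fin 2).1, h2 (finProdFinEquiv.symm i : Fin n × Fin 2).1]

/-- The pair enumeration conjugates a permutation of the vertices to a permutation of the pairs:
`ρ̂ = finProdFinEquiv ∘ (ρ × id) ∘ finProdFinEquiv⁻¹`. [folklore] -/
def pairPerm {n : ℕ} (ρ : Equiv.Perm (Fin n)) : Equiv.Perm (Fin (n * 2)) :=
  (finProdFinEquiv.symm.trans (ρ.prodCongr (Equiv.refl (Fin 2)))).trans finProdFinEquiv

omit [NeZero L] in
/-- `finProdFinEquiv.symm (ρ̂ i) = (ρ aᵢ, σᵢ)`. [folklore] -/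
theorem finProdFinEquiv_symm_pairPerm {n : ℕ} (ρ : Equiv.Perm (Fin n)) (i : Fin (n * 2)) :
    (finProdFinEquiv.symm (pairPerm ρ i) : Fin n × Fin 2) =
      (ρ (finProdFinEquiv.symm i : Fin n × Fin 2).1, (finProdFinEquiv.symm i : Fin n × Fin 2).2) := by
  simp [pairPerm]

/-- **Joint relabelling of the vertices does not change the limiting determinant**:
`vertexLimitDet (x ∘ ρ) (τ ∘ ρ) = vertexLimitDet x τ` (simultaneous row/column permutation `ρ̂`). [folklore] -/
theorem vertexLimitDet_perm (β μ : ℝ) {n : ℕ} (ρ : Equiv.Perm (Fin n)) (x : Fin n → TorusSite 2 L)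
    (τ : Fin n → ℝ) :
    vertexLimitDet L β μ (fun a => x (ρ a)) (fun a => τ (ρ a)) = vertexLimitDet L β μ x τ := by
  rw [vertexLimitDet, vertexLimitDet]
  conv_rhs => rw [← Matrix.det_submatrix_equiv_self (pairPerm ρ)]
  congr 1
  ext i j
  simp only [Matrix.submatrix_apply, Matrix.of_apply, finProdFinEquiv_symm_pairPerm]

/-- **The vertex sum of the limiting determinants is a symmetric function of the times**:
`Σ_{x⃗} vertexLimitDet x (c • (w ∘ ρ)) = Σ_{x⃗} vertexLimitDet x (c • w)`. [folklore] -/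
theorem sum_vertexLimitDet_perm (β μ c : ℝ) {n : ℕ} (ρ : Equiv.Perm (Fin n)) (w : Fin n → ℝ) :
    ∑ x : Fin n → TorusSite 2 L, vertexLimitDet L β μ x (c • fun a => w (ρ a)) =
      ∑ x : Fin n → TorusSite 2 L, vertexLimitDet L β μ x (c • w) := by
  have hre : ∀ x : Fin n → TorusSite 2 L, vertexLimitDet L β μ (fun a => x (ρ a)) (c • fun a => w (ρ a)) =
      vertexLimitDet L β μ x (c • w) := fun x => by
    have h1 : (c • fun a => w (ρ a)) = fun a => (c • w) (ρ a) := by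
      funext a; simp only [Pi.smul_apply, smul_eq_mul]
    rw [h1]
    exact vertexLimitDet_perm (L := L) β μ ρ x (c • w)
  calc ∑ x : Fin n → TorusSite 2 L, vertexLimitDet L β μ x (c • fun a => w (ρ a))
      = ∑ x : Fin n → TorusSite 2 L, vertexLimitDet L β μ (fun a => ((Equiv.arrowCongr ρ.symm
          (Equiv.refl (TorusSite 2 L))) x) a) (c • fun a => w (ρ a)) := by
        rw [← (Equiv.arrowCongr ρ.symm (Equiv.refl (TorusSite 2 L))).sum_comp]
    _ = ∑ x : Fin n → TorusSite 2 L, vertexLimitDet L β μ (fun a => x (ρ a)) (c • fun a => w (ρ a)) := by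
        refine sum_congr rfl fun x _ => ?_
        congr 1
    _ = _ := sum_congr rfl fun x _ => hre x

/-- The vertex sum is integrable on every bounded time box (bounded and measurable). [folklore] -/
theorem integrableOn_sum_vertexLimitDet_smul {β : ℝ} (hβ : 0 < β) (μ : ℝ) (n : ℕ) :
    IntegrableOn (fun u : Fin n → ℝ => ∑ x : Fin n → TorusSite 2 L, vertexLimitDet L β μ x (β • u))
      (Set.pi Set.univ fun _ : Fin n => Set.Icc (0 : ℝ) 1) volume := by
  have hset : Set.pi Set.univ (fun _ : Fin n => Set.Icc (0 : ℝ) 1) = Set.Icc (0 : Fin n → ℝ) (fun _ => 1) :=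
    Set.pi_univ_Icc _ _
  rw [hset]
  refine integrableOn_of_measurable_of_norm_le measurableSet_Icc
    (Literature.Analysis.Matrix.volume_Icc_cube_ne_top 1)
    (Finset.measurable_sum _ fun x _ => (measurable_vertexLimitDet β μ x).comp (measurable_const_smul β))
    (B := ∑ _x : Fin n → TorusSite 2 L,
      (((n * 2 : ℕ) : ℝ) * ((1 / (L : ℝ) ^ 2) * ∑ q : TorusSite 2 L, Real.exp (β * |nambuXi L μ q|)) ^ 2) ^ n)
    fun u hu => (norm_sum_le _ _).trans (sum_le_sum fun x _ => norm_vertexLimitDet_le β μ x ?_)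
  refine ⟨fun a => ?_, fun a => ?_⟩
  · have := hu.1 a
    simp only [Pi.smul_apply, smul_eq_mul, Pi.zero_apply] at this ⊢
    exact mul_nonneg hβ.le this
  · have := hu.2 a
    simp only [Pi.smul_apply, smul_eq_mul] at this ⊢
    nlinarith

/-- The limiting determinant is integrable on the time cube `[0,β]ⁿ`. [folklore] -/
theorem integrableOn_vertexLimitDet (β μ : ℝ) {n : ℕ} (x : Fin n → TorusSite 2 L) :
    IntegrableOn (fun τ : Fin n → ℝ => vertexLimitDet L β μ x τ) (Set.Icc (0 : Fin n → ℝ) fun _ => β) volume :=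
  integrableOn_of_measurable_of_norm_le measurableSet_Icc (Literature.Analysis.Matrix.volume_Icc_cube_ne_top β)
    (measurable_vertexLimitDet β μ x) fun _ hτ => norm_vertexLimitDet_le β μ x hτ

end LimitDet

/-! ### C. The Hamiltonian side on the torus: `propMatrix` as momentum sums, and the match on the simplex -/

section Match

variable {L : ℕ} [NeZero L]

/-- **The time-ordered propagator matrix of the torus in momentum form** (`L ≥ 3`): for pairs `m` with orbital
`(y_m, σ_m)` (creation = annihilation orbital) and complex times `s_m`,
`propMatrix(a,b) = [σ_b=σ_a] L⁻² Σ_k χ_k(y_b − y_a) e^{-(s_b−s_a)(ε_k−μ)} f_β(ε_k−μ)` if `a ≤ b`, and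
`−[σ_b=σ_a] L⁻² Σ_k χ_k(y_b − y_a) e^{-(s_b−s_a)(ε_k−μ)} f_{−β}(ε_k−μ)` otherwise (`f_{−β} = 1 − f_β`; BGM (1.4)).
[cite: BenfattoGiulianiMastropietro2006, §1.2 (1.4)] -/
theorem propMatrix_torus_orb_apply (hL : 3 ≤ L) (β μ : ℝ) {N : ℕ} (y : Fin N → FermionTorus 2 L)
    (σ : Fin N → Fin 2) (s : Fin N → ℂ) (a b : Fin N) :
    propMatrix β (hubbardOneBody (fermionTorusGraph 2 L) 1 μ) (fun m => orb (y m) (σ m)) (fun m => orb (y m) (σ m))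
        s a b =
      if a ≤ b then
        (if σ b = σ a then ((L : ℂ) ^ 2)⁻¹ * ∑ k : TorusSite 2 L,
          torusChar k ((y b).toTorusSite - (y a).toTorusSite) *
            (Complex.exp (-(s b - s a) * ((torusBand L k - μ : ℝ) : ℂ)) * (fermiFunction β (torusBand L k - μ) : ℂ))
          else 0)
      else
        -(if σ b = σ a then ((L : ℂ) ^ 2)⁻¹ * ∑ k : TorusSite 2 L,
          torusChar k ((y b).toTorusSite - (y a).toTorusSite) *
            (Complex.exp (-(s b - s a) * ((torusBand L k - μ : ℝ) : ℂ)) *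
              (fermiFunction (-β) (torusBand L k - μ) : ℂ))
          else 0) := by
  have e : ∀ γ : ℝ, NormedSpace.exp (-(s b • hubbardOneBody (fermionTorusGraph 2 L) 1 μ)) *
      (1 + NormedSpace.exp ((γ : ℂ) • hubbardOneBody (fermionTorusGraph 2 L) 1 μ))⁻¹ *
        NormedSpace.exp (s a • hubbardOneBody (fermionTorusGraph 2 L) 1 μ) =
      torusMultiplier fun k => Complex.exp (-(s b - s a) * ((torusBand L k - μ : ℝ) : ℂ)) *
        (fermiFunction γ (torusBand L k - μ) : ℂ) := by
    intro γ
    rw [fermiMatrix_torus_eq_freeFermiMatrix hL, freeFermiMatrix_eq_torusMultiplier,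
      show -(s b • hubbardOneBody (fermionTorusGraph 2 L) 1 μ) = (-s b) • hubbardOneBody (fermionTorusGraph 2 L) 1 μ
        from (neg_smul _ _).symm,
      exp_smul_hubbardOneBody_eq_torusMultiplier hL, exp_smul_hubbardOneBody_eq_torusMultiplier hL,
      torusMultiplier_mul, torusMultiplier_mul]
    congr 1
    funext k
    rw [mul_right_comm, ← Complex.exp_add]
    congr 2
    ring
  have hneg : -((β : ℂ) • hubbardOneBody (fermionTorusGraph 2 L) 1 μ) =
      (((-β : ℝ)) : ℂ) • hubbardOneBody (fermionTorusGraph 2 L) 1 μ := by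
    rw [Complex.ofReal_neg, neg_smul]
  simp only [propMatrix, Matrix.of_apply]
  rw [hneg, e β, e (-β), torusMultiplier_orb, torusMultiplier_orb]

/-- The standard pair enumeration in coordinates: `aᵢ = i / 2`. [folklore] -/
theorem finProdFinEquiv_symm_fst_val {n : ℕ} (i : Fin (n * 2)) :
    ((finProdFinEquiv.symm i : Fin n × Fin 2).1 : ℕ) = (i : ℕ) / 2 := by
  simp

/-- The standard pair enumeration in coordinates: `σᵢ = i % 2`. [folklore] -/
theorem finProdFinEquiv_symm_snd_val {n : ℕ} (i : Fin (n * 2)) :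
    ((finProdFinEquiv.symm i : Fin n × Fin 2).2 : ℕ) = (i : ℕ) % 2 := by
  simp

omit [NeZero L] in
/-- The `s < 0` branch of the time-ordered propagator. [folklore] -/
theorem timeOrderedPropagator_of_neg (β ξ : ℝ) {s : ℝ} (h : s < 0) :
    timeOrderedPropagator β ξ s = -((1 + Real.exp (β * ξ))⁻¹ * Real.exp (-(ξ * s))) := by
  rw [timeOrderedPropagator, if_neg (not_lt.2 h.le), if_pos h]

omit [NeZero L] in
/-- The `s > 0` branch of the time-ordered propagator. [folklore] -/
theorem timeOrderedPropagator_of_pos (β ξ : ℝ) {s : ℝ} (h : 0 < s) :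
    timeOrderedPropagator β ξ s = (1 + Real.exp (-(β * ξ)))⁻¹ * Real.exp (-(ξ * s)) := by
  rw [timeOrderedPropagator, if_pos h]

omit [NeZero L] in
/-- The midpoint value of the time-ordered propagator. [folklore] -/
theorem timeOrderedPropagator_zero (β ξ : ℝ) :
    timeOrderedPropagator β ξ 0 = 1 / 2 - (1 + Real.exp (β * ξ))⁻¹ := by
  rw [timeOrderedPropagator, if_neg (lt_irrefl 0), if_neg (lt_irrefl 0)]

omit [NeZero L] in
/-- Scalar match, `n_F` branch: `e^{-(s_b - s_a)ξ} f_β(ξ) = -G_β(ξ, βp - βr)` for `s = -βu`, `βp - βr < 0`. [folklore] -/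
theorem exp_mul_fermi_eq_neg_timeOrdered {β ξ p r : ℝ} (h : β * p - β * r < 0) :
    Complex.exp (-((r : ℂ) * -(β : ℂ) - (p : ℂ) * -(β : ℂ)) * (ξ : ℂ)) * ((fermiFunction β ξ : ℝ) : ℂ) =
      -((timeOrderedPropagator β ξ (β * p - β * r) : ℝ) : ℂ) := by
  rw [timeOrderedPropagator_of_neg β ξ h, fermiFunction]
  have hexp : Complex.exp (-((r : ℂ) * -(β : ℂ) - (p : ℂ) * -(β : ℂ)) * (ξ : ℂ)) =
      ((Real.exp (-(ξ * (β * p - β * r))) : ℝ) : ℂ) := by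
    rw [Complex.ofReal_exp]
    congr 1
    push_cast
    ring
  rw [hexp]
  push_cast
  ring

omit [NeZero L] in
/-- Scalar match, `1 - n_F` branch: `e^{-(s_b - s_a)ξ} f_{-β}(ξ) = G_β(ξ, βp - βr)` for `βp - βr > 0`. [folklore] -/
theorem exp_mul_fermi_neg_eq_timeOrdered {β ξ p r : ℝ} (h : 0 < β * p - β * r) :
    Complex.exp (-((r : ℂ) * -(β : ℂ) - (p : ℂ) * -(β : ℂ)) * (ξ : ℂ)) * ((fermiFunction (-β) ξ : ℝ) : ℂ) =
      ((timeOrderedPropagator β ξ (β * p - β * r) : ℝ) : ℂ) := by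
  rw [timeOrderedPropagator_of_pos β ξ h, fermiFunction]
  have hexp : Complex.exp (-((r : ℂ) * -(β : ℂ) - (p : ℂ) * -(β : ℂ)) * (ξ : ℂ)) =
      ((Real.exp (-(ξ * (β * p - β * r))) : ℝ) : ℂ) := by
    rw [Complex.ofReal_exp]
    congr 1
    push_cast
    ring
  rw [hexp, neg_mul, one_div]
  push_cast
  ring

/-- Scalar match on the diagonal: `L⁻² Σ_q f_β(ξ_q) - ½ = -L⁻² Σ_q (½ - f_β(ξ_q))`. [folklore] -/
theorem sum_fermi_sub_half_eq (β μ : ℝ) :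
    ((1 / (L : ℝ) ^ 2 : ℝ) : ℂ) * (∑ q : TorusSite 2 L, ((fermiFunction β (torusBand L q - μ) : ℝ) : ℂ)) -
        ((1 / 2 : ℝ) : ℂ) =
      -(((1 / (L : ℝ) ^ 2 : ℝ) : ℂ) * ∑ q : TorusSite 2 L,
        ((timeOrderedPropagator β (nambuXi L μ q) 0 : ℝ) : ℂ)) := by
  have hL : (L : ℂ) ≠ 0 := by exact_mod_cast NeZero.ne L
  have hcard : ((Fintype.card (TorusSite 2 L) : ℕ) : ℂ) = (L : ℂ) ^ 2 := by
    rw [Fintype.card_pi, prod_const, ZMod.card, card_univ, Fintype.card_fin, Nat.cast_pow]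
  simp only [timeOrderedPropagator_zero, nambuXi, fermiFunction, one_div]
  push_cast
  rw [Finset.sum_sub_distrib, Finset.sum_const, card_univ, nsmul_eq_mul, hcard]
  field_simp
  ring

/-- **On the open simplex the shifted Hamiltonian matrix is the transpose of the Grassmann limit matrix.**  For
`L ≥ 3`, `β > 0`, vertex sites `x⃗`, STRICTLY increasing times `u` and all pairs `i, j`:
`(propMatrix(x⃗, s = −βu) − ½·1)(i,j) = vertexLimitEntry(x⃗_{aⱼ}, x⃗_{aᵢ}, σⱼ, σᵢ; βu_{aᵢ} − βu_{aⱼ})` — the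
`a ≤ b` branch of BGM (1.4) against the `s < 0` branch of the time-ordered propagator, the `a > b` branch against
`s > 0`, and on the diagonal blocks the counterterm `½` against the midpoint `½ − n_F` of the symmetric frequency
truncation. [cite: BenfattoGiulianiMastropietro2006, §2.1 (2.3)-(2.8)] -/
theorem propMatrix_sub_half_eq_transpose_vertexLimit (hL : 3 ≤ L) {β : ℝ} (hβ : 0 < β) (μ : ℝ) {n : ℕ}
    (x : Fin n → TorusSite 2 L) {u : Fin n → ℝ} (hu : StrictMono u) (i j : Fin (n * 2)) :
    (propMatrix β (hubbardOneBody (fermionTorusGraph 2 L) 1 μ)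
        (fun m : Fin (n * 2) => orb (FermionTorus.ofTorusSite (x (finProdFinEquiv.symm m : Fin n × Fin 2).1))
          (finProdFinEquiv.symm m : Fin n × Fin 2).2)
        (fun m : Fin (n * 2) => orb (FermionTorus.ofTorusSite (x (finProdFinEquiv.symm m : Fin n × Fin 2).1))
          (finProdFinEquiv.symm m : Fin n × Fin 2).2)
        (fun m : Fin (n * 2) => (((u (finProdFinEquiv.symm m : Fin n × Fin 2).1 : ℝ) : ℂ) * -(β : ℂ))) -
        ((1 / 2 : ℝ) : ℂ) • (1 : Matrix (Fin (n * 2)) (Fin (n * 2)) ℂ)) i j =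
      vertexLimitEntry L β μ (x (finProdFinEquiv.symm j : Fin n × Fin 2).1)
        (x (finProdFinEquiv.symm i : Fin n × Fin 2).1) (finProdFinEquiv.symm j : Fin n × Fin 2).2
        (finProdFinEquiv.symm i : Fin n × Fin 2).2
        ((β • u) (finProdFinEquiv.symm i : Fin n × Fin 2).1 - (β • u) (finProdFinEquiv.symm j : Fin n × Fin 2).1) := by
  have hvi : (((finProdFinEquiv.symm i : Fin n × Fin 2).1 : Fin n) : ℕ) = (i : ℕ) / 2 := finProdFinEquiv_symm_fst_val i
  have hvj : (((finProdFinEquiv.symm j : Fin n × Fin 2).1 : Fin n) : ℕ) = (j : ℕ) / 2 := finProdFinEquiv_symm_fst_val j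
  have hwi : (((finProdFinEquiv.symm i : Fin n × Fin 2).2 : Fin 2) : ℕ) = (i : ℕ) % 2 := finProdFinEquiv_symm_snd_val i
  have hwj : (((finProdFinEquiv.symm j : Fin n × Fin 2).2 : Fin 2) : ℕ) = (j : ℕ) % 2 := finProdFinEquiv_symm_snd_val j
  have hL2 : ((L : ℂ) ^ 2)⁻¹ = ((1 / (L : ℝ) ^ 2 : ℝ) : ℂ) := by push_cast; rw [one_div]
  rw [Matrix.sub_apply, Matrix.smul_apply, Matrix.one_apply, propMatrix_torus_orb_apply hL,
    vertexLimitEntry_eq_torusChar]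
  simp only [FermionTorus.toTorusSite_ofTorusSite, smul_eq_mul, mul_ite, mul_one, mul_zero, Pi.smul_apply, hL2]
  rcases lt_trichotomy ((finProdFinEquiv.symm i : Fin n × Fin 2).1) ((finProdFinEquiv.symm j : Fin n × Fin 2).1)
    with hlt | heq | hgt
  · -- `aᵢ < aⱼ`: `i < j`, the `n_F` branch against `s < 0`
    have hlt' : (((finProdFinEquiv.symm i : Fin n × Fin 2).1 : Fin n) : ℕ) <
        (((finProdFinEquiv.symm j : Fin n × Fin 2).1 : Fin n) : ℕ) := hlt
    have hij : i ≤ j := by rw [Fin.le_iff_val_le_val]; omega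
    have hne : i ≠ j := by intro h; subst h; exact lt_irrefl _ hlt
    have hs : β * u (finProdFinEquiv.symm i : Fin n × Fin 2).1 - β * u (finProdFinEquiv.symm j : Fin n × Fin 2).1 < 0 := by
      have := hu hlt
      nlinarith
    rw [if_pos hij, if_neg hne, sub_zero]
    split_ifs with hσ
    · rw [← mul_neg, ← Finset.sum_neg_distrib]
      refine congrArg _ (sum_congr rfl fun q _ => ?_)
      rw [← mul_neg]
      exact congrArg _ (exp_mul_fermi_eq_neg_timeOrdered hs)
    · rw [neg_zero]
  · -- `aᵢ = aⱼ`: the diagonal blocks, counterterm `½` against the midpoint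
    have heq' : (((finProdFinEquiv.symm i : Fin n × Fin 2).1 : Fin n) : ℕ) =
        (((finProdFinEquiv.symm j : Fin n × Fin 2).1 : Fin n) : ℕ) := congrArg Fin.val heq
    by_cases hij : i = j
    · subst hij
      rw [if_pos le_rfl, if_pos rfl, if_pos rfl, if_pos rfl]
      simp only [sub_self, torusChar_zero_right, one_mul, neg_zero, zero_mul, Complex.exp_zero]
      exact sum_fermi_sub_half_eq β μ
    · have hσ : ¬ (finProdFinEquiv.symm j : Fin n × Fin 2).2 = (finProdFinEquiv.symm i : Fin n × Fin 2).2 := by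
        intro h
        have h' := congrArg Fin.val h
        have hij' : (i : ℕ) ≠ (j : ℕ) := fun h'' => hij (Fin.ext h'')
        omega
      rw [if_neg hij, sub_zero, if_neg hσ, if_neg hσ, neg_zero, if_neg hσ, neg_zero]
      split_ifs <;> rfl
  · -- `aᵢ > aⱼ`: `i > j`, the `1 - n_F` branch against `s > 0`
    have hgt' : (((finProdFinEquiv.symm j : Fin n × Fin 2).1 : Fin n) : ℕ) <
        (((finProdFinEquiv.symm i : Fin n × Fin 2).1 : Fin n) : ℕ) := hgt
    have hij : ¬ i ≤ j := by rw [Fin.le_iff_val_le_val]; omega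
    have hne : i ≠ j := by intro h; subst h; exact lt_irrefl _ hgt
    have hs : 0 < β * u (finProdFinEquiv.symm i : Fin n × Fin 2).1 - β * u (finProdFinEquiv.symm j : Fin n × Fin 2).1 := by
      have := hu hgt
      nlinarith
    rw [if_neg hij, if_neg hne, sub_zero]
    split_ifs with hσ
    · refine congrArg Neg.neg (congrArg _ (sum_congr rfl fun q _ => ?_))
      exact congrArg _ (exp_mul_fermi_neg_eq_timeOrdered hs)
    · rfl

/-- **The limiting Wick determinant on the open simplex is the shifted Hamiltonian determinant**:
for `L ≥ 3`, `β > 0` and strictly increasing `u`,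
`vertexLimitDet x (β • u) = det(propMatrix(x⃗, −βu) − ½·1)` (transpose). [cite: BenfattoGiulianiMastropietro2006, §2.1 (2.6)-(2.8)] -/
theorem vertexLimitDet_smul_eq_det_propMatrix_sub_half (hL : 3 ≤ L) {β : ℝ} (hβ : 0 < β) (μ : ℝ) {n : ℕ}
    (x : Fin n → TorusSite 2 L) {u : Fin n → ℝ} (hu : StrictMono u) :
    vertexLimitDet L β μ x (β • u) =
      (propMatrix β (hubbardOneBody (fermionTorusGraph 2 L) 1 μ)
        (fun m : Fin (n * 2) => orb (FermionTorus.ofTorusSite (x (finProdFinEquiv.symm m : Fin n × Fin 2).1))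
          (finProdFinEquiv.symm m : Fin n × Fin 2).2)
        (fun m : Fin (n * 2) => orb (FermionTorus.ofTorusSite (x (finProdFinEquiv.symm m : Fin n × Fin 2).1))
          (finProdFinEquiv.symm m : Fin n × Fin 2).2)
        (fun m : Fin (n * 2) => (((u (finProdFinEquiv.symm m : Fin n × Fin 2).1 : ℝ) : ℂ) * -(β : ℂ))) -
        ((1 / 2 : ℝ) : ℂ) • (1 : Matrix (Fin (n * 2)) (Fin (n * 2)) ℂ)).det := by
  rw [vertexLimitDet, ← Matrix.det_transpose]
  congr 1
  ext i j
  rw [Matrix.transpose_apply, Matrix.of_apply, propMatrix_sub_half_eq_transpose_vertexLimit hL hβ μ x hu i j]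

end Match

/-! ### D. Assembly: the limit series is the renormalised Hamiltonian series at `ν = ½` -/

section Assembly

variable {L : ℕ} [NeZero L]

/-- The Hamiltonian-side integrand `u ↦ Σ_{x⃗} det(propMatrix(x⃗, −βu) − ½·1)` is continuous (the branches of
`propMatrix` are decided by the pair ORDER, not by the times). [folklore] -/
theorem continuous_sum_det_propMatrix_sub_half (β μ : ℝ) (n : ℕ) :
    Continuous fun u : Fin n → ℝ => ∑ x : Fin n → TorusSite 2 L,
      (propMatrix β (hubbardOneBody (fermionTorusGraph 2 L) 1 μ)
        (fun m : Fin (n * 2) => orb (FermionTorus.ofTorusSite (x (finProdFinEquiv.symm m : Fin n × Fin 2).1))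
          (finProdFinEquiv.symm m : Fin n × Fin 2).2)
        (fun m : Fin (n * 2) => orb (FermionTorus.ofTorusSite (x (finProdFinEquiv.symm m : Fin n × Fin 2).1))
          (finProdFinEquiv.symm m : Fin n × Fin 2).2)
        (fun m : Fin (n * 2) => (((u (finProdFinEquiv.symm m : Fin n × Fin 2).1 : ℝ) : ℂ) * -(β : ℂ))) -
        ((1 / 2 : ℝ) : ℂ) • (1 : Matrix (Fin (n * 2)) (Fin (n * 2)) ℂ)).det := by
  refine continuous_finsetSum _ fun x _ => Continuous.matrix_det ?_
  refine continuous_pi fun i => continuous_pi fun j => ?_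
  simp only [Matrix.sub_apply]
  refine Continuous.sub ?_ continuous_const
  exact continuous_propMatrix_apply β _ _ _ _
    (fun a => (Complex.continuous_ofReal.comp (continuous_apply _)).mul continuous_const) i j

/-- **The order-`n` term of the Grassmann limit series is the order-`n` term of the renormalised Hamiltonian series
(`ν = ½`), normalised by `Z₀`**: `((−1)ⁿ/n!) Uⁿ Σ_{x⃗} ∫_{[0,β]ⁿ} vertexLimitDet = Z₀⁻¹ · Uⁿ I_n((−β)ⁿ Σ_f Z₀ det(propMatrix − ½·1))`
(`L ≥ 3`, `β > 0`; scaling `τ = βu`, symmetrisation over the `n!` simplices, and the match on the open simplex).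
[cite: BenfattoGiulianiMastropietro2006, §2.1 (2.6)-(2.8)] -/
theorem vertexLimitDet_term_eq (hL : 3 ≤ L) {β : ℝ} (hβ : 0 < β) (μ U : ℝ) (n : ℕ) :
    ((-1 : ℂ) ^ n * ((n ! : ℂ))⁻¹) * ((U : ℂ) ^ n * ∑ x : Fin n → TorusSite 2 L,
        ∫ τ in Set.Icc (0 : Fin n → ℝ) (fun _ => β), vertexLimitDet L β μ x τ) =
      (Matrix.partitionFn β (dGamma (hubbardOneBody (fermionTorusGraph 2 L) 1 μ)))⁻¹ *
        ((U : ℂ) ^ n * orderedIntegral n (fun u : Fin n → ℝ =>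
          (-(β : ℂ)) ^ n * ∑ f : Fin n → FermionTorus 2 L,
            Matrix.partitionFn β (dGamma (hubbardOneBody (fermionTorusGraph 2 L) 1 μ)) *
              (propMatrix β (hubbardOneBody (fermionTorusGraph 2 L) 1 μ)
                (fun m : Fin (n * 2) => orb (f (finProdFinEquiv.symm m : Fin n × Fin 2).1)
                  (finProdFinEquiv.symm m : Fin n × Fin 2).2)
                (fun m : Fin (n * 2) => orb (f (finProdFinEquiv.symm m : Fin n × Fin 2).1)
                  (finProdFinEquiv.symm m : Fin n × Fin 2).2)
                (fun m : Fin (n * 2) => (((u (finProdFinEquiv.symm m : Fin n × Fin 2).1 : ℝ) : ℂ) * -(β : ℂ))) -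
                ((1 / 2 : ℝ) : ℂ) • (1 : Matrix (Fin (n * 2)) (Fin (n * 2)) ℂ)).det) 1) := by
  haveI : Nonempty (Finset (Orb (FermionTorus 2 L))) := ⟨∅⟩
  set h₀ := hubbardOneBody (fermionTorusGraph 2 L) 1 μ with hh₀
  set Z₀ : ℂ := Matrix.partitionFn β (dGamma h₀) with hZ₀def
  have hZ₀ : Z₀ ≠ 0 := (Matrix.partitionFn_pos β (isHermitian_dGamma (isHermitian_hubbardOneBody _ 1 μ))).ne'
  -- the Hamiltonian-side integrand indexed by torus sites
  set Q : (Fin n → TorusSite 2 L) → (Fin n → ℝ) → Matrix (Fin (n * 2)) (Fin (n * 2)) ℂ := fun x u =>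
    propMatrix β h₀
      (fun m : Fin (n * 2) => orb (FermionTorus.ofTorusSite (x (finProdFinEquiv.symm m : Fin n × Fin 2).1))
        (finProdFinEquiv.symm m : Fin n × Fin 2).2)
      (fun m : Fin (n * 2) => orb (FermionTorus.ofTorusSite (x (finProdFinEquiv.symm m : Fin n × Fin 2).1))
        (finProdFinEquiv.symm m : Fin n × Fin 2).2)
      (fun m : Fin (n * 2) => (((u (finProdFinEquiv.symm m : Fin n × Fin 2).1 : ℝ) : ℂ) * -(β : ℂ))) -
      ((1 / 2 : ℝ) : ℂ) • (1 : Matrix (Fin (n * 2)) (Fin (n * 2)) ℂ) with hQ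
  set P : (Fin n → ℝ) → ℂ := fun u => ∑ x : Fin n → TorusSite 2 L, (Q x u).det with hP
  have hPcont : Continuous P := by
    simp only [hP, hQ]
    exact continuous_sum_det_propMatrix_sub_half β μ n
  -- (1) the Hamiltonian sum over `f` is the sum over torus sites, constants out
  have hsumf : ∀ u : Fin n → ℝ, ∑ f : Fin n → FermionTorus 2 L, Z₀ *
      (propMatrix β h₀
        (fun m : Fin (n * 2) => orb (f (finProdFinEquiv.symm m : Fin n × Fin 2).1) (finProdFinEquiv.symm m : Fin n × Fin 2).2)
        (fun m : Fin (n * 2) => orb (f (finProdFinEquiv.symm m : Fin n × Fin 2).1) (finProdFinEquiv.symm m : Fin n × Fin 2).2)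
        (fun m : Fin (n * 2) => (((u (finProdFinEquiv.symm m : Fin n × Fin 2).1 : ℝ) : ℂ) * -(β : ℂ))) -
        ((1 / 2 : ℝ) : ℂ) • (1 : Matrix (Fin (n * 2)) (Fin (n * 2)) ℂ)).det = Z₀ * P u := by
    intro u
    rw [hP, Finset.mul_sum]
    refine Fintype.sum_equiv ((Equiv.refl (Fin n)).arrowCongr FermionTorus.equivTorusSite) _ _ fun f => ?_
    simp [hQ, FermionTorus.equivTorusSite]
  have hoI : orderedIntegral n (fun u : Fin n → ℝ => (-(β : ℂ)) ^ n * ∑ f : Fin n → FermionTorus 2 L, Z₀ *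
      (propMatrix β h₀
        (fun m : Fin (n * 2) => orb (f (finProdFinEquiv.symm m : Fin n × Fin 2).1) (finProdFinEquiv.symm m : Fin n × Fin 2).2)
        (fun m : Fin (n * 2) => orb (f (finProdFinEquiv.symm m : Fin n × Fin 2).1) (finProdFinEquiv.symm m : Fin n × Fin 2).2)
        (fun m : Fin (n * 2) => (((u (finProdFinEquiv.symm m : Fin n × Fin 2).1 : ℝ) : ℂ) * -(β : ℂ))) -
        ((1 / 2 : ℝ) : ℂ) • (1 : Matrix (Fin (n * 2)) (Fin (n * 2)) ℂ)).det) 1 =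
      orderedIntegral n P 1 * ((-(β : ℂ)) ^ n * Z₀) := by
    rw [← orderedIntegral_mul_const]
    congr 1
    funext u
    rw [hsumf u]
    ring
  -- (2) the Grassmann side: sum inside, scale, symmetrise
  have hS : ∑ x : Fin n → TorusSite 2 L, ∫ τ in Set.Icc (0 : Fin n → ℝ) (fun _ => β), vertexLimitDet L β μ x τ =
      ∫ τ in Set.Icc (0 : Fin n → ℝ) (fun _ => β), ∑ x : Fin n → TorusSite 2 L, vertexLimitDet L β μ x τ :=
    (integral_finsetSum _ fun x _ => integrableOn_vertexLimitDet β μ x).symm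
  have hscale := setIntegral_Icc_eq_pow_mul_setIntegral_unit_cube (k := n) hβ
    (fun τ => ∑ x : Fin n → TorusSite 2 L, vertexLimitDet L β μ x τ)
  have hsymm := setIntegral_cube_eq_factorial_mul_setIntegral_simplex n 1
    (fun u : Fin n → ℝ => ∑ x : Fin n → TorusSite 2 L, vertexLimitDet L β μ x (β • u))
    (fun σ w => sum_vertexLimitDet_perm β μ β σ w) (integrableOn_sum_vertexLimitDet_smul hβ μ n)
  -- (3) on the simplex the two integrands agree a.e.
  have hsimplex : ∫ u in {w : Fin n → ℝ | (∀ i, w i ∈ Set.Icc (0 : ℝ) 1) ∧ Monotone w},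
      ∑ x : Fin n → TorusSite 2 L, vertexLimitDet L β μ x (β • u) =
      ∫ u in {w : Fin n → ℝ | (∀ i, w i ∈ Set.Icc (0 : ℝ) 1) ∧ Monotone w}, P u := by
    rw [← setIntegral_congr_set (strictSimplex_one_ae_eq_simplex n 1),
      ← setIntegral_congr_set (strictSimplex_one_ae_eq_simplex n 1)]
    refine setIntegral_congr_fun (measurableSet_strictSimplex n 1 1) fun u hu => ?_
    have hu' : StrictMono u := by simpa using hu.2
    simp only [hP, hQ]
    exact sum_congr rfl fun x _ => vertexLimitDet_smul_eq_det_propMatrix_sub_half hL hβ μ x hu'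
  have hord : ∫ u in {w : Fin n → ℝ | (∀ i, w i ∈ Set.Icc (0 : ℝ) 1) ∧ Monotone w}, P u = orderedIntegral n P 1 :=
    (orderedIntegral_eq_setIntegral_simplex n P hPcont 1 zero_le_one).symm
  -- (4) assemble
  rw [hoI, hS, hscale, hsymm, hsimplex, hord]
  have hfac : (n ! : ℂ) ≠ 0 := by exact_mod_cast n.factorial_ne_zero
  field_simp
  rw [neg_pow, ← mul_pow]
  ring

/-- **The Grassmann limit series sums to the renormalised Hamiltonian trace**: for `L ≥ 3`, `β > 0` and every `U`,
`Σ_n ((−1)ⁿ/n!) Uⁿ Σ_{x⃗} ∫_{[0,β]ⁿ} vertexLimitDet = e^{−βUL²/4} · Tr e^{−β(H_L(1,U) − (μ+U/2)N)} / Tr e^{−β(H_L(1,0) − μN)}`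
(`hasSum_hubbard_partitionFn_renormalised_det` at `ν = ½`). [cite: BenfattoGiulianiMastropietro2006, §2.1 (2.6)-(2.8)] -/
theorem hasSum_vertexLimitDet_series (hL : 3 ≤ L) {β : ℝ} (hβ : 0 < β) (μ U : ℝ) :
    HasSum (fun n : ℕ => ((-1 : ℂ) ^ n * ((n ! : ℂ))⁻¹) * ((U : ℂ) ^ n * ∑ x : Fin n → TorusSite 2 L,
        ∫ τ in Set.Icc (0 : Fin n → ℝ) (fun _ => β), vertexLimitDet L β μ x τ))
      ((Real.exp (-(β * U / 4 * (L : ℝ) ^ 2)) : ℂ) * Matrix.partitionFn β (hubbardTorusWith 2 L 1 U (μ + U / 2)) /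
        Matrix.partitionFn β (hubbardTorusWith 2 L 1 0 μ)) := by
  haveI : Nonempty (Finset (Orb (FermionTorus 2 L))) := ⟨∅⟩
  set Z₀ : ℂ := Matrix.partitionFn β (dGamma (hubbardOneBody (fermionTorusGraph 2 L) 1 μ)) with hZ₀def
  have hZ₀ : Z₀ ≠ 0 := (Matrix.partitionFn_pos β (isHermitian_dGamma (isHermitian_hubbardOneBody _ 1 μ))).ne'
  -- (`const_smul`, not `mul_left`: keeps the `AddCommMonoid ℂ` instance of the plain statement)
  have hs := (hasSum_hubbard_partitionFn_renormalised_det (fermionTorusGraph 2 L) β 1 U μ (1 / 2)).const_smul Z₀⁻¹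
  simp only [smul_eq_mul] at hs
  have h1 : hubbardTorusWith 2 L 1 U (μ + U / 2) = hamiltonianWith (fermionTorusGraph 2 L) 1 U (μ + U * (1 / 2)) := by
    rw [show μ + U / 2 = μ + U * (1 / 2) by ring]
    rfl
  have h2 : Matrix.partitionFn β (hubbardTorusWith 2 L 1 0 μ) = Z₀ := by
    rw [hZ₀def, ← hamiltonianWith_zero_eq_dGamma]
    rfl
  have h3 : ((Real.exp (-(β * U / 4 * (L : ℝ) ^ 2)) : ℝ) : ℂ) =
      ((Real.exp (-(β * (U * (1 / 2) ^ 2 * (Fintype.card (FermionTorus 2 L) : ℝ))))) : ℂ) := by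
    rw [show Fintype.card (FermionTorus 2 L) = L ^ 2 by
      rw [show Fintype.card (FermionTorus 2 L) = Fintype.card (Fin 2 → Fin L) from Fintype.card_lex _,
        Fintype.card_fun, Fintype.card_fin, Fintype.card_fin]]
    push_cast
    ring_nf
  rw [h1, h2, h3]
  simp_rw [vertexLimitDet_term_eq hL hβ μ U]
  have hval : ((Real.exp (-(β * (U * (1 / 2) ^ 2 * (Fintype.card (FermionTorus 2 L) : ℝ))))) : ℂ) *
      Matrix.partitionFn β (hamiltonianWith (fermionTorusGraph 2 L) 1 U (μ + U * (1 / 2))) / Z₀ =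
      Z₀⁻¹ * (((Real.exp (-(β * (U * (1 / 2) ^ 2 * (Fintype.card (FermionTorus 2 L) : ℝ))))) : ℂ) *
        Matrix.partitionFn β (hamiltonianWith (fermionTorusGraph 2 L) 1 U (μ + U * (1 / 2)))) := by
    rw [div_eq_mul_inv]
    ring
  rw [hval]
  -- `convert`: the `Fintype`/`DecidableEq` instances on `Finset (Orb (FermionTorus 2 L))` baked into the
  -- Hamiltonian-side statement differ (propositionally trivially) from the ones synthesised here
  convert hs using 12

/-- **THE BRIDGE: the Matsubara ultraviolet limit of the Grassmann partition function is the Hamiltonian trace.**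
For `L ≥ 3`, `β > 0` and `2e · |U| · L²β · B² < 1` (`B = L⁻² Σ_{k⃗}(2 + β|ξ_{k⃗}|/3)`), as `M → ∞`
`∫dμ_{C_M} e^{-V_M(U)} ⟶ e^{-βUL²/4} · Z_L(β; U, μ + U/2) / Z_L(β; 0, μ)`, `Z_L(β; U, μ) = Tr e^{-β hubbardTorusWith 2 L 1 U μ}`:
the symmetric-truncation Grassmann representation with interaction `U∫ψ⁺↑ψ⁻↑ψ⁺↓ψ⁻↓` describes the Hubbard torus
with the half-filling-symmetrised interaction `UΣ(n↑−½)(n↓−½)`. [cite: BenfattoGiulianiMastropietro2006, §2.1 (2.6)-(2.8)] -/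
theorem tendsto_effPartitionFn_hubbard_eq_partitionFn_div (hL : 3 ≤ L) {β : ℝ} (hβ : 0 < β) (μ : ℝ) {U : ℝ}
    (hU : 2 * Real.exp 1 * (|U| * (L : ℝ) ^ 2 * β) *
      ((1 / (L : ℝ) ^ 2) * ∑ q : TorusSite 2 L, (2 + β * |nambuXi L μ q| / 3)) ^ 2 < 1) :
    Tendsto (fun M : ℕ => effPartitionFn ℂ (hubbardCovariance L M β μ 0) (hubbardInteraction L M β U)) atTop
      (𝓝 ((Real.exp (-(β * U / 4 * (L : ℝ) ^ 2)) : ℂ) * Matrix.partitionFn β (hubbardTorusWith 2 L 1 U (μ + U / 2)) /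
        Matrix.partitionFn β (hubbardTorusWith 2 L 1 0 μ))) := by
  rw [← (hasSum_vertexLimitDet_series hL hβ μ U).tsum_eq]
  exact tendsto_effPartitionFn_hubbard_zero_seed hβ μ hU

end Assembly

end Literature.MathematicalPhysics.QuantumLattice
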